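import Mathlib.LinearAlgebra.FiniteDimensional.Lemmas
import Mathlib.LinearAlgebra.Matrix.ToLin
import Mathlib.RingTheory.Finiteness.Basic
import Mathlib.Algebra.Algebra.Subalgebra.Basic
import HarnessLib

/-!
# The block module `ε·W` of a faithful representation (Peirce block of an idempotent, as a module)
# (Shimura 1998 §5.1; Lam, *First Course* §21)

Layer `Literature/RingTheory/SimpleModule`, namespace `Literature.RingTheory.SimpleModule`.

Pure linear algebra.  Let `ψ : D → End_k(W)` be an injective `k`-algebra homomorphism (a FAITHFUL representation of `D` on a
finite-dimensional `W`), `H ⊆ D` a subalgebra, `ε ∈ H` an idempotent commuting with `H`, and `φ : Z → D` a `k`-linear multiplicative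
injection of a field `Z` with `φ(1) = ε`, `φ(Z) ⊆ H` central in `H` (a «block field» `Z ≅ Z·ε ⊆ Z(H)·ε`, the output shape of
`RingTheory/Idempotents/PositiveInvolutionCentreBlockField`).  Then the BLOCK `V := ψ(ε)·W = range ψ(ε)` is

* a `Z`-vector space (`z • v := ψ(φ z) v`), finite over `Z`, with `k`-compatible scalars;
* an `H`-module through the `k`-algebra homomorphism `act : H → End_k(V)`, `act h = ψ(h)|_V`, by `Z`-LINEAR operators
  (`act h (z • v) = z • act h v` — the hypothesis `hHZ` of `EndomorphismAlgebraFullRankOneProjector`);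
* faithful for `εH`: `act h = 0 ↔ ε h = 0`; non-zero iff `ε ≠ 0`;
* with ranks read in `W`: `dim_k range (act h) = dim_k range ψ(ε h)`.

Main results: `exists_blockModule_of_faithful` (operators on any `W`), `exists_blockModule_of_matrixRep` (`ψ : D → M_ι(k)`, `W = k^ι`,
column vectors `Matrix.mulVecLin`).

USE (cell `hodgecm-mathlib`, D-0151, crux `HLiu418` = stmt-HodgeConjecture-24832, d6 card S2′ degree road): instantiated at the rational
representation `ψ` of `ComplexMultiplication/RationalRepresentationTateComparison` ((D2)) it produces the `(V, H ⊆ End_k V, hHZ)` input of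
`EndomorphismAlgebraFullRankOneProjector.exists_mem_isIdempotentElem_finrank_range_eq` ((D1)); the rank clause feeds (D4) through the
`ℓ`-adic comparison.
-/

namespace Literature.RingTheory.SimpleModule

open Module Function
open scoped Matrix

universe u v w x

section Block

variable {k : Type u} [Field k] {D : Type v} [Ring D] [Algebra k D] {W : Type w} [AddCommGroup W] [Module k W]
  (ψ : D →ₐ[k] Module.End k W) (H : Subalgebra k D) {ε : D}

/-- `ψ(h)` preserves the block `range ψ(ε)` when `ε h = h ε`. [folklore] -/
private theorem map_mem_range_of_commute {h : D} (hc : ε * h = h * ε) {v : W} (hv : v ∈ LinearMap.range (ψ ε)) :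
    ψ h v ∈ LinearMap.range (ψ ε) := by
  obtain ⟨w, rfl⟩ := hv
  refine ⟨ψ h w, ?_⟩
  change (ψ ε * ψ h) w = (ψ h * ψ ε) w
  rw [← map_mul, ← map_mul, hc]

/-- `ψ(ε)` is the identity on the block `range ψ(ε)` (`ε² = ε`). [folklore] -/
private theorem apply_eq_self_of_mem_range (hε : IsIdempotentElem ε) {v : W} (hv : v ∈ LinearMap.range (ψ ε)) : ψ ε v = v := by
  obtain ⟨w, rfl⟩ := hv
  change (ψ ε * ψ ε) w = ψ ε w
  rw [← map_mul, hε.eq]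

/-- **The block module of a faithful representation.**  For `ψ : D → End_k(W)` injective, `H ⊆ D` a subalgebra, `ε ∈ H` idempotent
commuting with `H`, and a block field `φ : Z → H` (`k`-linear, multiplicative, `φ 1 = ε`, central in `H`): on `V := range ψ(ε)` there are
a `Z`-vector-space structure with `(z • v : W) = ψ(φ z) v`, compatible with `k` and finite over `Z`, and a `k`-algebra homomorphism
`act : H → End_k(V)` with `(act h v : W) = ψ(h) v`, by `Z`-linear operators, `act (φ z) = (z • ·)`, faithful on `εH`
(`act h = 0 ↔ ε h = 0`), `V ≠ 0` if `ε ≠ 0`, and `dim_k range (act h) = dim_k range ψ(ε h)`.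
[cite: Shimura1998, §5.1 Proposition 1 (p. 36) and Propositions 3–4 (p. 37)] [cite: Lam2001FirstCourse, §21 Prop. (21.8)] -/
theorem exists_blockModule_of_faithful [FiniteDimensional k W] (hψ : Injective ψ) (hεH : ε ∈ H) (hε : IsIdempotentElem ε)
    (hεc : ∀ h ∈ H, ε * h = h * ε) {Z : Type x} [Field Z] [Algebra k Z] (φ : Z →ₗ[k] D)
    (hφmul : ∀ a b, φ (a * b) = φ a * φ b) (hφ1 : φ 1 = ε) (hφH : ∀ z, φ z ∈ H) (hφc : ∀ z, ∀ h ∈ H, φ z * h = h * φ z) :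
    ∃ (_ : Module Z (LinearMap.range (ψ ε))) (_ : IsScalarTower k Z (LinearMap.range (ψ ε)))
      (_ : Module.Finite Z (LinearMap.range (ψ ε))) (act : H →ₐ[k] Module.End k (LinearMap.range (ψ ε))),
      (∀ (h : H) (v : LinearMap.range (ψ ε)), ((act h v : LinearMap.range (ψ ε)) : W) = ψ h v) ∧
      (∀ (z : Z) (v : LinearMap.range (ψ ε)), ((z • v : LinearMap.range (ψ ε)) : W) = ψ (φ z) v) ∧
      (∀ (h : H) (z : Z) (v : LinearMap.range (ψ ε)), act h (z • v) = z • act h v) ∧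
      (∀ (z : Z) (v : LinearMap.range (ψ ε)), act ⟨φ z, hφH z⟩ v = z • v) ∧
      (∀ h : H, act h = 0 ↔ ε * h = 0) ∧
      (ε ≠ 0 → Nontrivial (LinearMap.range (ψ ε))) ∧
      (∀ h : H, finrank k (LinearMap.range (act h)) = finrank k (LinearMap.range (ψ (ε * h)))) := by
  set V : Submodule k W := LinearMap.range (ψ ε) with hV
  -- `act h = ψ(h)|_V`
  let act₀ : H → Module.End k V := fun h ↦ (ψ h).restrict fun v hv ↦ map_mem_range_of_commute ψ (hεc h h.2) hv
  have hact₀ : ∀ (h : H) (v : V), ((act₀ h v : V) : W) = ψ h v := fun _ _ ↦ rfl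
  let act : H →ₐ[k] Module.End k V :=
    { toFun := act₀
      map_one' := LinearMap.ext fun v ↦ Subtype.ext (by rw [hact₀, OneMemClass.coe_one, map_one]; rfl)
      map_mul' := fun h h' ↦ LinearMap.ext fun v ↦ Subtype.ext (by
        rw [hact₀, Subalgebra.coe_mul, map_mul]; rfl)
      map_zero' := LinearMap.ext fun v ↦ Subtype.ext (by rw [hact₀, ZeroMemClass.coe_zero, map_zero]; rfl)
      map_add' := fun h h' ↦ LinearMap.ext fun v ↦ Subtype.ext (by
        rw [hact₀, Subalgebra.coe_add, map_add]; rfl)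
      commutes' := fun r ↦ LinearMap.ext fun v ↦ Subtype.ext (by
        rw [hact₀, Subalgebra.coe_algebraMap, AlgHom.commutes, Module.algebraMap_end_apply, Module.algebraMap_end_apply,
          Submodule.coe_smul]) }
  have hact : ∀ (h : H) (v : V), ((act h v : V) : W) = ψ h v := fun _ _ ↦ rfl
  -- the `Z`-action through `θ : Z →+* End_k(V)`, `θ z = act (φ z)`
  have hφε : act ⟨ε, hεH⟩ = 1 := LinearMap.ext fun v ↦ Subtype.ext (by
    rw [hact]; exact apply_eq_self_of_mem_range ψ hε v.2)
  let θ : Z →+* Module.End k V :=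
    { toFun := fun z ↦ act ⟨φ z, hφH z⟩
      map_one' := by simp_rw [hφ1]; exact hφε
      map_mul' := fun a b ↦ by rw [← map_mul]; exact congrArg act (Subtype.ext (hφmul a b))
      map_zero' := by rw [← map_zero act]; exact congrArg act (Subtype.ext (map_zero φ))
      map_add' := fun a b ↦ by rw [← map_add]; exact congrArg act (Subtype.ext (map_add φ a b)) }
  have hθ : ∀ z, θ z = act ⟨φ z, hφH z⟩ := fun _ ↦ rfl
  letI modZ : Module Z V := Module.compHom V θ
  have hsmul : ∀ (z : Z) (v : V), z • v = act ⟨φ z, hφH z⟩ v := fun _ _ ↦ rfl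
  haveI hST : IsScalarTower k Z V := ⟨fun r z v ↦ by
    rw [hsmul, hsmul, ← LinearMap.smul_apply, ← map_smul]
    exact congrArg (fun h : H ↦ act h v) (Subtype.ext (map_smul φ r z))⟩
  haveI hfin : Module.Finite Z V := Module.Finite.of_restrictScalars_finite k Z V
  refine ⟨modZ, hST, hfin, act, hact, fun z v ↦ by rw [hsmul, hact], fun h z v ↦ ?_, fun z v ↦ (hsmul z v).symm,
    fun h ↦ ?_, fun hε0 ↦ ?_, fun h ↦ ?_⟩
  · -- `Z`-linearity of `act h`: `h` commutes with `φ z`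
    rw [hsmul, hsmul, ← Module.End.mul_apply, ← map_mul, ← Module.End.mul_apply, ← map_mul]
    exact congrArg (fun x : H ↦ act x v) (Subtype.ext (hφc z h h.2).symm)
  · -- faithfulness on `εH`
    constructor
    · intro h0
      rw [hεc h h.2]
      apply hψ
      rw [map_mul, map_zero]
      refine LinearMap.ext fun w ↦ ?_
      have := congrArg (fun f : Module.End k V ↦ ((f ⟨ψ ε w, LinearMap.mem_range_self _ w⟩ : V) : W)) h0
      rw [hact, LinearMap.zero_apply, ZeroMemClass.coe_zero] at this
      rw [Module.End.mul_apply, LinearMap.zero_apply]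
      exact this
    · intro h0
      refine LinearMap.ext fun v ↦ Subtype.ext ?_
      obtain ⟨w, hw⟩ := v.2
      rw [hact, LinearMap.zero_apply, ZeroMemClass.coe_zero, ← hw]
      change (ψ h * ψ ε) w = 0
      rw [← map_mul, ← hεc h h.2, h0, map_zero, LinearMap.zero_apply]
  · -- `V ≠ 0`
    refine (Submodule.nontrivial_iff_ne_bot).2 fun hbot ↦ hε0 (hψ ?_)
    rw [map_zero]
    exact LinearMap.range_eq_bot.1 hbot
  · -- ranks read in `W`
    have h2 : V.subtype ∘ₗ act h = ψ h ∘ₗ V.subtype := LinearMap.ext fun v ↦ hact h v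
    have h1 : (LinearMap.range (act h)).map V.subtype = LinearMap.range (ψ (ε * h)) := by
      rw [← LinearMap.range_comp, h2, LinearMap.range_comp, Submodule.range_subtype, hV, ← LinearMap.range_comp,
        hεc h h.2, map_mul, Module.End.mul_eq_comp]
    rw [← h1, Submodule.finrank_map_subtype_eq]

end Block

section MatrixRep

variable {k : Type u} [Field k] {D : Type v} [Ring D] [Algebra k D] {ι : Type w} [Fintype ι] [DecidableEq ι]
  (ψ : D →ₐ[k] Matrix ι ι k) (H : Subalgebra k D) {ε : D}

/-- **The block module of a faithful MATRIX representation** (`exists_blockModule_of_faithful` at `W = k^ι`, operators `M ↦ (M *ᵥ ·)` =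
`Matrix.mulVecLin`): the block `V := range (ψ ε *ᵥ ·)` is a finite `Z`-vector space and an `H`-module by `Z`-linear operators
`act h = (ψ h *ᵥ ·)|_V`, faithful on `εH`, non-zero if `ε ≠ 0`, with `dim_k range (act h) = dim_k range (ψ(ε h) *ᵥ ·)`.
[cite: Shimura1998, §5.1 Proposition 1 (p. 36) and Propositions 3–4 (p. 37)] [cite: Lam2001FirstCourse, §21 Prop. (21.8)] -/
theorem exists_blockModule_of_matrixRep (hψ : Injective ψ) (hεH : ε ∈ H) (hε : IsIdempotentElem ε)
    (hεc : ∀ h ∈ H, ε * h = h * ε) {Z : Type x} [Field Z] [Algebra k Z] (φ : Z →ₗ[k] D)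
    (hφmul : ∀ a b, φ (a * b) = φ a * φ b) (hφ1 : φ 1 = ε) (hφH : ∀ z, φ z ∈ H) (hφc : ∀ z, ∀ h ∈ H, φ z * h = h * φ z) :
    ∃ (_ : Module Z (LinearMap.range (Matrix.mulVecLin (ψ ε))))
      (_ : IsScalarTower k Z (LinearMap.range (Matrix.mulVecLin (ψ ε))))
      (_ : Module.Finite Z (LinearMap.range (Matrix.mulVecLin (ψ ε))))
      (act : H →ₐ[k] Module.End k (LinearMap.range (Matrix.mulVecLin (ψ ε)))),
      (∀ (h : H) (v : LinearMap.range (Matrix.mulVecLin (ψ ε))),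
          ((act h v : LinearMap.range (Matrix.mulVecLin (ψ ε))) : ι → k) = ψ h *ᵥ (v : ι → k)) ∧
      (∀ (z : Z) (v : LinearMap.range (Matrix.mulVecLin (ψ ε))),
          ((z • v : LinearMap.range (Matrix.mulVecLin (ψ ε))) : ι → k) = ψ (φ z) *ᵥ (v : ι → k)) ∧
      (∀ (h : H) (z : Z) (v : LinearMap.range (Matrix.mulVecLin (ψ ε))), act h (z • v) = z • act h v) ∧
      (∀ (z : Z) (v : LinearMap.range (Matrix.mulVecLin (ψ ε))), act ⟨φ z, hφH z⟩ v = z • v) ∧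
      (∀ h : H, act h = 0 ↔ ε * h = 0) ∧
      (ε ≠ 0 → Nontrivial (LinearMap.range (Matrix.mulVecLin (ψ ε)))) ∧
      (∀ h : H, finrank k (LinearMap.range (act h)) = finrank k (LinearMap.range (Matrix.mulVecLin (ψ (ε * h))))) := by
  -- `M ↦ (M *ᵥ ·)` is an injective `k`-algebra homomorphism `M_ι(k) → End_k(k^ι)`
  let Ψ : D →ₐ[k] Module.End k (ι → k) := (Matrix.toLinAlgEquiv' : Matrix ι ι k ≃ₐ[k] _).toAlgHom.comp ψ
  have hΨ : ∀ x, Ψ x = Matrix.mulVecLin (ψ x) := fun _ ↦ rfl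
  have hΨinj : Injective Ψ := (Matrix.toLinAlgEquiv' : Matrix ι ι k ≃ₐ[k] _).injective.comp hψ
  obtain ⟨modZ, hST, hfin, act, hact, hsmul, hHZ, hφact, hker, hnt, hrank⟩ :=
    exists_blockModule_of_faithful Ψ H hΨinj hεH hε hεc φ hφmul hφ1 hφH hφc
  exact ⟨modZ, hST, hfin, act, fun h v ↦ (hact h v).trans (by rw [hΨ]; rfl), fun z v ↦ (hsmul z v).trans (by rw [hΨ]; rfl),
    hHZ, hφact, hker, hnt, hrank⟩

end MatrixRep

end Literature.RingTheory.SimpleModule
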